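import Literature.NumberTheory.Sieve.FGKMT2018Theorem1OfTheorem5

/-!
# Ford–Green–Konyagin–Maynard–Tao 2018: Theorem 3 (probabilistic covering) and Corollary 3 hold

Trunk: AntSieve / parity (long-gaps ladder, FGKMT 2018).

K. Ford, B. Green, S. Konyagin, J. Maynard, T. Tao, *Long gaps between primes*, J. Amer. Math. Soc.
31 (2018), 65–105: Theorem 3 (the hypergraph covering theorem, §5) is PROVED in the tree with the
explicit constant `C₀ = 10` (`Literature.Combinatorics.Hypergraph.fgkmt2018_theorem3`, file
`Combinatorics/Hypergraph/FGKMT2018Theorem3Proof`), and Corollary 3 (its specialisation to the random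
edge systems of the sieve, §4.3) follows unconditionally (`Literature.NumberTheory.Sieve.fgkmt2018_corollary3`,
file `FGKMT2018Theorem1OfTheorem5`, via `fgkmt2018_corollary3_of_theorem3`).  This leaf gives the two
named facts their exact `_holds` names (D-0026 bookkeeping: the proof terms are those existing
theorems; no statement, definition or attribute is edited; no new named fact; both facts were listed
unproved by the ledger's debt table at +60 min after the provers landed).

## References

* K. Ford, B. Green, S. Konyagin, J. Maynard, T. Tao, *Long gaps between primes*, J. Amer. Math.
  Soc. 31 (2018), 65–105 = arXiv:1412.5029, Theorem 3 (§5, pp. 19–21) and Corollary 3 (§4.3,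
  pp. 11–13). [FordGreenKonyaginMaynardTao2018]
-/

namespace Literature.Combinatorics.Hypergraph

/-- **FGKMT 2018, Theorem 3 (probabilistic covering)**, unconditionally, under the fact's exact name:
the tree's `fgkmt2018_theorem3` (constant `C₀ = 10`).
[cite: FordGreenKonyaginMaynardTao2018, Theorem 3; §5 pp. 19–21] -/
theorem FGKMT2018_theorem3_holds : Literature.Combinatorics.Hypergraph.FGKMT2018_theorem3 :=
  fgkmt2018_theorem3

end Literature.Combinatorics.Hypergraph

namespace Literature.NumberTheory.Sieve

/-- **FGKMT 2018, Corollary 3** (realisations of the random edges leaving at most `K 5^{-m} #V`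
vertices uncovered), unconditionally, under the fact's exact name: the tree's `fgkmt2018_corollary3`
(= `fgkmt2018_corollary3_of_theorem3` applied to Theorem 3).
[cite: FordGreenKonyaginMaynardTao2018, Cor 3 (proof, §4.3 pp. 12–13)] -/
theorem FGKMT2018_corollary3_holds : Literature.NumberTheory.Sieve.FGKMT2018_corollary3 :=
  fgkmt2018_corollary3

end Literature.NumberTheory.Sieve
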